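import Literature.Computability.QuantumComplexity.CliffordTPathSums
import Literature.Computability.Complexity.CoinCounting
import HarnessLib

/-!
# The Adleman–DeMarrais–Huang pair count: total path semantics, pair weights and coin counting

Machine-independent half of the proof of the named fact
`Literature.Computability.QuantumComplexity.BQP_subset_PP` (`BQP.lean`; Adleman–DeMarrais–Huang 1997,
Thm. 6.4 and Lemma 6.10: `BQP ⊆ PP`), continuing `CliffordTPathSums.lean` (paths `pathRun`, the
count `adhW = 4𝔄 + 3𝔅` and its sign `adhW_pos` / `adhW_neg`). The polynomial-time machine of
`ADHMachine.lean` realises the nondeterministic machine `M'` of the printed proof (p. 1538): it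
reads two guessed paths `b, b'` (one choice bit per gate) and three more guessed bits `c`, follows
both paths through the gate list, and answers "yes" iff the value of `c` is below `4 + wt(b, b')`,
where the *pair weight* `wt ∈ {0, ±3, ±4}` is the signed integer weight `± (4 reA + 3 reB)` of the
phase-difference class of the pair when both paths are valid and end at the same label, and `0`
otherwise (the "trivial guesses" of step 4, answered yes/no in equal numbers). This file supplies
what the counting argument needs about that machine, stated without machines:

* `tStep`, `tRun` — the **total** path semantics the machine computes (an invalid choice bit does
  not stop the walk, it clears a validity flag; phases are kept modulo `8`; a missing choice bit
  reads as `0`), and `tRun_spec`: agreement with `pathRun` (endpoint, phase mod `8`, validity);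
* `wt8 d = 4 reA d + 3 reB d`, the pair weight `wtPair`, and **`sum_wtPair`**:
  `Σ_{b, b'} wtPair = adhW` (exchange of the sums over endpoints and over pairs);
  `wtPair_eq_of_tRun`: the pair weight read off the two total runs, as the machine does;
* `threshold t c = [⟦c⟧ < t]` on three coin bits and `cnt_threshold`: exactly `t` of the eight
  values of `c` pass (`0 ≤ t ≤ 8`) — "there are `abs(a_{P₁,0} a_{P₂,0})` sets of pairs `G₁, G₂` for
  each value of `E`" in the printed proof;
* `cnt_add_eq_sum` — splitting a count of coin strings of length `a + k` over the first block;
* `acceptProbOn_eq_probAcc` — the acceptance probability of an oracle-free family is the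
  `probAcc` of `CliffordTPathSums.lean` (one rewrite by `prodZeta_omega`), and the degenerate
  register: `gates_eq_nil_of_zero` (no gate fits on `0` wires), `adhW_nil_zero`.

## References

* L. M. Adleman, J. DeMarrais, M.-D. A. Huang, *Quantum computability*, SIAM J. Comput. 26
  (1997) 1524–1540: Thm. 6.4 (p. 1534), Lemma 6.10 (p. 1538) and its proof (pp. 1538–1539:
  the machine `M'`, steps 1–5; "the number of yes outputs minus the number of no outputs").
* J. Gill, *Computational complexity of probabilistic Turing machines*, SIAM J. Comput. 6 (1977),
  Def. 5.1 (`PP` by strict majority).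
-/

noncomputable section

namespace Literature.Computability.QuantumComplexity

open _root_.Computability Complexity Cryptography

namespace ADH

variable {N : ℕ}

/-! ### Total path semantics -/

/-- The state of a walk along a computational path: current basis label, phase exponent of `ω`
modulo `8`, validity flag. [folklore] -/
abbrev TState (N : ℕ) : Type := QReg N × ℕ × Bool

/-- **One total step.** As `pathStep`, but total: the choice bit of a non-branching gate only
clears the validity flag when it is `1` (the gate still acts), the phase is reduced modulo `8`,
and an oracle gate (absent from the oracle-free circuits of `BQP`) just clears the flag.
[cite: AdlemanDeMarraisHuang1997, §6 Lemma 6.10 (proof, step 3: "use P₁ to choose a path … compute the configuration C₁")] -/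
def tStep : QGate cliffordT N → Bool → TState N → TState N
  | .gate .H e, c, (w, φ, v) =>
      (Function.update w (embH e 0) c, (φ + if w (embH e 0) && c then 4 else 0) % 8, v)
  | .gate .S e, c, (w, φ, v) => (w, (φ + if w (embS e 0) then 2 else 0) % 8, v && !c)
  | .gate .T e, c, (w, φ, v) => (w, (φ + if w (embT e 0) then 1 else 0) % 8, v && !c)
  | .gate .CNOT e, c, (w, φ, v) =>
      (Function.update w (embC e 1) (w (embC e 1) ^^ w (embC e 0)), φ % 8, v && !c)
  | .oracle _ _, _, (w, φ, _) => (w, φ % 8, false)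

/-- The choice bit read off a coin list: its first bit, `0` if there is none. [folklore] -/
def headBit (cs : List Bool) : Bool := decide (cs.take 1 = [true])

/-- `headBit (c :: cs) = c`. [folklore] -/
@[simp] theorem headBit_cons (c : Bool) (cs : List Bool) : headBit (c :: cs) = c := by
  cases c <;> simp [headBit]

/-- `headBit [] = false`. [folklore] -/
@[simp] theorem headBit_nil : headBit [] = false := by simp [headBit]

/-- **The total walk** through a gate list driven by a coin list (one coin per gate, read with
`headBit`, surplus coins ignored). [cite: AdlemanDeMarraisHuang1997, §6 Lemma 6.10 (proof, step 3)] -/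
def tRun : List (QGate cliffordT N) → List Bool → TState N → TState N
  | [], _, s => s
  | g :: gs, cs, s => tRun gs cs.tail (tStep g (headBit cs) s)

/-- An invalid walk stays invalid. [folklore] -/
theorem tStep_false (g : QGate cliffordT N) (c : Bool) (w : QReg N) (φ : ℕ) :
    (tStep g c (w, φ, false)).2.2 = false := by
  cases g with
  | gate op e => cases op <;> simp [tStep]
  | oracle k e => simp [tStep]

/-- An invalid walk stays invalid to the end. [folklore] -/
theorem tRun_false (gs : List (QGate cliffordT N)) : ∀ (cs : List Bool) (w : QReg N) (φ : ℕ),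
    (tRun gs cs (w, φ, false)).2.2 = false := by
  induction gs with
  | nil => intro cs w φ; rfl
  | cons g gs ih =>
    intro cs w φ
    simp only [tRun]
    rcases hs : tStep g (headBit cs) (w, φ, false) with ⟨w', φ', v'⟩
    have hv : v' = false := by simpa [hs] using tStep_false g (headBit cs) w φ
    subst hv
    exact ih _ _ _

/-- A total step from a valid state agrees with `pathStep`: same label, phase increment reduced
modulo `8`, and the flag records whether the step was valid. [folklore] -/
theorem tStep_true (g : QGate cliffordT N) (c : Bool) (w : QReg N) (φ : ℕ) :
    tStep g c (w, φ, true) =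
      match pathStep g c w with
      | some (w', ψ) => (w', (φ + ψ) % 8, true)
      | none => ((tStep g c (w, φ, true)).1, (tStep g c (w, φ, true)).2.1, false) := by
  cases g with
  | oracle k e => simp [tStep, pathStep]
  | gate op e =>
    cases op with
    | H => simp [tStep, pathStep]
    | S => cases c <;> simp [tStep, pathStep]
    | T => cases c <;> simp [tStep, pathStep]
    | CNOT => cases c <;> simp [tStep, pathStep]

/-- **The total walk computes the path.** From a valid state and with at least one coin per gate:
if the path with choice bits `cs ↾ |gs|` is valid with endpoint `z` and phase exponent `ψ`, the
walk ends at `(z, (φ + ψ) mod 8, valid)`; otherwise it ends invalid.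
[cite: AdlemanDeMarraisHuang1997, §6 (p. 1534, paths; Lemma 6.10, proof, step 3)] -/
theorem tRun_spec (gs : List (QGate cliffordT N)) : ∀ (cs : List Bool) (w : QReg N) (φ : ℕ),
    φ < 8 → gs.length ≤ cs.length →
    match pathRun gs w (cs.take gs.length) with
    | some (z, ψ) => tRun gs cs (w, φ, true) = (z, (φ + ψ) % 8, true)
    | none => (tRun gs cs (w, φ, true)).2.2 = false := by
  induction gs with
  | nil =>
    intro cs w φ hφ _
    simp [pathRun, tRun, Nat.mod_eq_of_lt hφ]
  | cons g gs ih =>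
    intro cs w φ hφ hlen
    cases cs with
    | nil => simp at hlen
    | cons c cs =>
      simp only [List.length_cons, Nat.add_le_add_iff_right] at hlen
      simp only [List.length_cons, List.take_succ_cons, pathRun, tRun, List.tail_cons, headBit_cons]
      rw [tStep_true]
      rcases hps : pathStep g c w with _ | ⟨w', ψ⟩
      · simp only
        exact tRun_false gs cs _ _
      · simp only
        have h := ih cs w' ((φ + ψ) % 8) (Nat.mod_lt _ (by norm_num)) hlen
        rcases hpr : pathRun gs w' (cs.take gs.length) with _ | ⟨z, ψ'⟩
        · simp only [hpr, Option.map_none] at h ⊢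
          exact h
        · simp only [hpr, Option.map_some] at h ⊢
          rw [h]
          simp only [Prod.mk.injEq, true_and, and_true]
          rw [Nat.mod_add_mod, Nat.add_assoc]

/-! ### Pair weights -/

/-- The integer weight `4 reA d + 3 reB d ∈ {0, ±3, ±4}` of a phase-difference class `d` (the
irrational `√2/2` of the odd classes rounded to `3/4`). [cite: AdlemanDeMarraisHuang1997, §6 Lemma 6.10 (proof, p. 1539: W = 4𝔄 + 3𝔅 in `CliffordTPathSums`)] -/
def wt8 (d : ℕ) : ℤ := 4 * reA d + 3 * reB d

/-- The values of `wt8` on the eight classes. [folklore] -/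
theorem wt8_values : wt8 0 = 4 ∧ wt8 1 = 3 ∧ wt8 2 = 0 ∧ wt8 3 = -3 ∧ wt8 4 = -4 ∧ wt8 5 = -3 ∧
    wt8 6 = 0 ∧ wt8 7 = 3 := by
  simp [wt8, reA, reB]

/-- `|wt8 d| ≤ 4`. [folklore] -/
theorem abs_wt8_le (d : ℕ) : |wt8 d| ≤ 4 := by
  unfold wt8
  rcases d with _ | _ | _ | _ | _ | _ | _ | _ | d <;> simp [reA, reB]

variable {M : ℕ}

/-- **The pair weight** of two choice strings from `|w⟩`: `sign(z) · wt8 ((φ − φ') mod 8)` if both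
paths are valid and end at the same label `z` (phases `φ`, `φ'`), and `0` otherwise — the "yes"
minus "no" balance, per value of the extra guess `E`, of the guesses `⟨P₁, ·, P₂, ·, E⟩` of the
ADH machine. [cite: AdlemanDeMarraisHuang1997, §6 Lemma 6.10 (proof, steps 4–5)] -/
def wtPair (gs : List (QGate cliffordT M)) (w : QReg M) (bs bs' : List Bool) : ℤ :=
  match pathRun gs w bs, pathRun gs w bs' with
  | some (z₁, φ), some (z₂, φ') => if z₁ = z₂ then accSign z₁ * wt8 ((φ + 7 * φ') % 8) else 0
  | _, _ => 0

/-- `|wtPair| ≤ 4`. [folklore] -/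
theorem abs_wtPair_le (gs : List (QGate cliffordT M)) (w : QReg M) (bs bs' : List Bool) :
    |wtPair gs w bs bs'| ≤ 4 := by
  unfold wtPair
  rcases pathRun gs w bs with _ | ⟨z₁, φ⟩ <;> rcases pathRun gs w bs' with _ | ⟨z₂, φ'⟩ <;>
    simp only [abs_zero] <;> try norm_num
  split_ifs
  · rw [abs_mul]
    have h1 : |accSign z₁| = 1 := by unfold accSign; split_ifs <;> simp
    rw [h1, one_mul]
    exact abs_wt8_le _
  · simp

/-- Summing the `wt8`-weighted pair classes over the endpoints gives the pair weight (at most one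
endpoint is hit). [folklore] -/
theorem sum_accSign_pairDiff (gs : List (QGate cliffordT M)) (w : QReg M) (bs bs' : List Bool) :
    ∑ z : QReg M, accSign z * (match pairDiff gs w z bs bs' with | some d => wt8 d | none => 0) =
      wtPair gs w bs bs' := by
  unfold wtPair pairDiff
  rcases pathRun gs w bs with _ | ⟨z₁, φ⟩ <;> rcases pathRun gs w bs' with _ | ⟨z₂, φ'⟩
  · simp
  · simp
  · simp
  · simp only
    by_cases h : z₁ = z₂
    · subst h
      rw [if_pos rfl, Finset.sum_eq_single z₁]
      · simp
      · intro z _ hz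
        rw [if_neg (fun h' => hz h'.1.symm)]
        simp
      · intro h'; exact absurd (Finset.mem_univ _) h'
    · rw [if_neg h]
      refine Finset.sum_eq_zero fun z _ => ?_
      rw [if_neg (fun h' => h (h'.1.trans h'.2.symm))]
      simp

/-- **The ADH count is the sum of the pair weights**: `Σ_{b, b'} wtPair = W = 4𝔄 + 3𝔅`.
[cite: AdlemanDeMarraisHuang1997, §6 Lemma 6.10 (proof, p. 1539: "If we count the number of yes outputs minus the number of no outputs we get …")] -/
theorem sum_wtPair (gs : List (QGate cliffordT M)) (w : QReg M) :
    ∑ b : Fin gs.length → Bool, ∑ b' : Fin gs.length → Bool,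
        wtPair gs w (List.ofFn b) (List.ofFn b') = adhW gs w := by
  simp only [← sum_accSign_pairDiff]
  have hswap : ∀ f : QReg M → (Fin gs.length → Bool) → (Fin gs.length → Bool) → ℤ,
      ∑ b : Fin gs.length → Bool, ∑ b' : Fin gs.length → Bool, ∑ z : QReg M, f z b b' =
        ∑ z : QReg M, ∑ b : Fin gs.length → Bool, ∑ b' : Fin gs.length → Bool, f z b b' := by
    intro f
    calc ∑ b : Fin gs.length → Bool, ∑ b' : Fin gs.length → Bool, ∑ z : QReg M, f z b b'
        = ∑ b : Fin gs.length → Bool, ∑ z : QReg M, ∑ b' : Fin gs.length → Bool, f z b b' :=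
          Finset.sum_congr rfl fun b _ => Finset.sum_comm
      _ = ∑ z : QReg M, ∑ b : Fin gs.length → Bool, ∑ b' : Fin gs.length → Bool, f z b b' :=
          Finset.sum_comm
  rw [hswap]
  unfold adhW adhA adhB pairSumA pairSumB
  simp only [Finset.mul_sum, ← Finset.sum_add_distrib]
  refine Finset.sum_congr rfl fun z _ => Finset.sum_congr rfl fun b _ =>
    Finset.sum_congr rfl fun b' _ => ?_
  rcases pairDiff gs w z (List.ofFn b) (List.ofFn b') with _ | d
  · simp
  · simp only [wt8]
    ring

/-- **The pair weight read off the two total walks** (what the machine computes): both flags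
set and equal endpoints give `sign · wt8` of the difference of the two phase registers, anything
else gives `0`. [cite: AdlemanDeMarraisHuang1997, §6 Lemma 6.10 (proof, steps 3–5)] -/
theorem wtPair_eq_of_tRun (gs : List (QGate cliffordT M)) (w : QReg M) (cs cs' : List Bool)
    (h : gs.length ≤ cs.length) (h' : gs.length ≤ cs'.length) :
    wtPair gs w (cs.take gs.length) (cs'.take gs.length) =
      (let r := tRun gs cs (w, 0, true)
       let r' := tRun gs cs' (w, 0, true)
       if r.2.2 = true ∧ r'.2.2 = true ∧ r.1 = r'.1 then
         accSign r.1 * wt8 ((r.2.1 + 7 * r'.2.1) % 8) else 0) := by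
  have h1 := tRun_spec gs cs w 0 (by norm_num) h
  have h2 := tRun_spec gs cs' w 0 (by norm_num) h'
  unfold wtPair
  rcases hp : pathRun gs w (cs.take gs.length) with _ | ⟨z₁, φ⟩ <;>
    rcases hp' : pathRun gs w (cs'.take gs.length) with _ | ⟨z₂, φ'⟩ <;>
    simp only [hp, hp'] at h1 h2 ⊢
  · simp [h1]
  · simp [h1]
  · simp [h2]
  · simp only [h1, h2, zero_add, true_and]
    by_cases hz : z₁ = z₂
    · subst hz
      rw [if_pos rfl, if_pos rfl]
      congr 2
      omega
    · rw [if_neg hz, if_neg hz]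

/-! ### Three more coins: the threshold test -/

/-- The answer of the machine on the three extra coins `c`: "yes" iff `⟦c⟧ < t`
(`⟦c⟧ = bitsToNat c ∈ {0, …, 7}`, `t = 4 + wt`). [cite: AdlemanDeMarraisHuang1997, §6 Lemma 6.10 (proof, steps 4–5: the guesses G₁, G₂, E)] -/
def threshold (t : ℤ) (c : List Bool) : Bool := decide ((bitsToNat c : ℤ) < t)

/-- **Exactly `t` of the eight three-bit strings pass the threshold `t`** (`0 ≤ t ≤ 8`).
[cite: AdlemanDeMarraisHuang1997, §6 Lemma 6.10 (proof: "there are abs(a_{P₁,0} a_{P₂,0}) sets of pairs G₁, G₂ for each value of E")] -/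
theorem cnt_threshold (t : ℤ) (h0 : 0 ≤ t) (h8 : t ≤ 8) :
    (cnt 3 {c | threshold t c = true} : ℤ) = t := by
  classical
  rw [show (3 : ℕ) = 0 + 1 + 1 + 1 from rfl]
  repeat rw [cnt_succ]
  simp only [cnt_zero, Set.mem_setOf_eq, threshold, bitsToNat_cons, bitsToNat_nil,
    Bool.toNat_false, Bool.toNat_true, decide_eq_true_eq]
  push_cast
  interval_cases t <;> norm_num

/-! ### Splitting a count over the first block of coins -/

/-- **Counting by blocks**: the number of strings of length `a + k` in `E` is the sum over the
first block `u ∈ {0,1}^a` of the number of continuations `v ∈ {0,1}^k` with `u v ∈ E`. [folklore] -/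
theorem cnt_add_eq_sum (a k : ℕ) (E : Set (List Bool)) :
    cnt (a + k) E = ∑ u : List.Vector Bool a, cnt k {v | u.toList ++ v ∈ E} := by
  induction a generalizing E with
  | zero =>
    rw [Fintype.sum_subsingleton _ List.Vector.nil]
    simp
  | succ a ih =>
    rw [show a + 1 + k = (a + k) + 1 by omega, cnt_succ, ih, ih]
    classical
    let e : Bool × List.Vector Bool a ≃ List.Vector Bool (a + 1) :=
      { toFun := fun p => p.1 ::ᵥ p.2
        invFun := fun v => (v.head, v.tail)
        left_inv := fun p => by simp
        right_inv := fun v => List.Vector.cons_head_tail v }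
    rw [← Fintype.sum_equiv e (fun p => cnt k {u | (p.1 ::ᵥ p.2).toList ++ u ∈ E})
      (fun v => cnt k {u | v.toList ++ u ∈ E}) (fun _ => rfl),
      Fintype.sum_prod_type, Fintype.sum_bool]
    simp only [List.Vector.toList_cons, List.cons_append, Set.mem_setOf_eq]
    rw [Nat.add_comm]

/-- Sums over `List.Vector Bool n` are sums over `Fin n → Bool` along `List.ofFn`. [folklore] -/
theorem sum_vector_eq_sum_fn {β : Type*} [AddCommMonoid β] (n : ℕ) (f : List Bool → β) :
    ∑ u : List.Vector Bool n, f u.toList = ∑ b : Fin n → Bool, f (List.ofFn b) := by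
  refine (Fintype.sum_equiv (Equiv.vectorEquivFin Bool n).symm (fun b => f (List.ofFn b))
    (fun u => f u.toList) fun b => ?_).symm
  simp [Equiv.vectorEquivFin]

/-- A count in which every string of length `k` qualifies, or none does. [folklore] -/
theorem cnt_const (k : ℕ) (P : Prop) [Decidable P] :
    cnt k {_v | P} = if P then 2 ^ k else 0 := by
  split_ifs with h
  · exact cnt_eq_two_pow_of_forall fun y _ => h
  · have := (cnt_pos_iff k {_v : List Bool | P}).not
    simp only [not_lt, Nat.le_zero, Set.mem_setOf_eq] at this
    exact this.2 fun ⟨_, _, hP⟩ => h hP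

/-! ### The acceptance probability of a family as `probAcc` -/

/-- The label of the padded input: `|x 0^m⟩` read as a bit list is `x 0^m`. [folklore] -/
theorem ofFn_padInput (x : List Bool) (m : ℕ) :
    List.ofFn (padInput x.get m) = x ++ List.replicate m false := by
  rw [padInput, List.ofFn_fin_append, List.ofFn_get, List.ofFn_const]

/-- **Bridge to `CliffordTPathSums`.** For an oracle-free family, the acceptance probability on
`x` is `probAcc ω` of the gate list of the `|x|`-th circuit on the padded input (nonempty
register). [folklore] -/
theorem acceptProbOn_eq_probAcc {F : QCircuitFamily cliffordT} (hF : F.IsOracleFree)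
    (A : Language Bool) (x : List Bool) (hM : 0 < x.length + F.ancillas x.length) :
    F.acceptProbOn A x =
      probAcc omega (F.circ x.length).gates (padInput x.get (F.ancillas x.length)) hM := by
  unfold QCircuitFamily.acceptProbOn QCircuit.acceptProb probAcc QCircuit.runOn
  rw [← prodZeta_omega A (hF x.length)]
  refine Finset.sum_congr rfl fun z _ => ?_
  rw [dif_pos hM]

/-- On the empty register the acceptance probability is the junk value `0`. [folklore] -/
theorem acceptProbOn_eq_zero {F : QCircuitFamily cliffordT} (A : Language Bool) (x : List Bool)
    (hM : x.length + F.ancillas x.length = 0) : F.acceptProbOn A x = 0 := by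
  unfold QCircuitFamily.acceptProbOn QCircuit.acceptProb
  refine Finset.sum_eq_zero fun z _ => ?_
  rw [dif_neg (by omega)]

/-- No Clifford+T gate (nor oracle gate) can be placed on `0` wires. [folklore] -/
theorem isEmpty_qgate_zero : IsEmpty (QGate cliffordT 0) := by
  constructor
  rintro (⟨op, e⟩ | ⟨k, e⟩)
  · have h1 : 0 < cliffordT.arity op := by cases op <;> decide
    exact (e ⟨0, h1⟩).elim0
  · exact (e 0).elim0

/-- Hence a circuit on `0` wires has no gates. [folklore] -/
theorem gates_eq_nil_of_zero (C : QCircuit cliffordT 0) : C.gates = [] := by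
  rcases h : C.gates with _ | ⟨g, _⟩
  · rfl
  · exact (isEmpty_qgate_zero.false g).elim

/-- On the empty register the ADH count of the empty circuit is `W = -4` (one pair of empty
paths, ending at the unique label, which is rejecting by convention). [folklore] -/
theorem adhW_nil_zero (w : QReg 0) : adhW ([] : List (QGate cliffordT 0)) w = -4 := by
  have hA : adhA ([] : List (QGate cliffordT 0)) w = -1 := by
    unfold adhA pairSumA
    rw [Fintype.sum_subsingleton _ w]
    simp [accSign, pairDiff, pathRun, reA]
  have hB : adhB ([] : List (QGate cliffordT 0)) w = 0 := by
    unfold adhB pairSumB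
    rw [Fintype.sum_subsingleton _ w]
    simp [pairDiff, pathRun, reB]
  rw [adhW, hA, hB]
  rfl

end ADH

end Literature.Computability.QuantumComplexity
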